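import Literature.MathematicalPhysics.KineticTheory.HardSphereCampbellWindowBounds
import Literature.MathematicalPhysics.KineticTheory.HardSphereCampbellFluxStatics
import Literature.MathematicalPhysics.KineticTheory.HardSphereCampbellWindows
import Literature.MathematicalPhysics.KineticTheory.HardSphereCampbellSharpCount
import HarnessLib

/-!
# The sharp upper bound of the Campbell identity for energy-shell marks

Input `UB` of the assembly `hardSphereCampbellFormula_dim_of` of the stationary collision-rate
(Campbell / special-flow) identity `HardSphereCampbellFormula` (Cercignani–Illner–Pulvirenti 1994,
App. 4.A): for the hard-sphere flow on `T^d` (`0 < ε < 1/2`) and the flow-invariant shell mark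
`g₀ = c · 1{E ≤ E₀}`,
`∫ CPS_{(0,τ]}(g₀) dLiouville ≤ τ · outgoingCollisionFlux ε N g₀ < ∞` (`campbell_upperBound`).

Proof: the collision pair sum of `g₀` counts each collision of the orbit twice on the shell
(`collisionPairSum_shellMark`), the SHARP collision-count bound
`lintegral_ncard_collisionTimes_le_of_hitPiece_volume` (GST's window/truncation bookkeeping) applies
with the one-window volume bound `campbell_volume_hitPiece_shell_le`, and the sum over unordered
pairs of the pair fluxes is the outgoing flux (`outgoingCollisionFlux_eq_sum_lt`, by the symmetry
`pairFlux_swap`); finiteness is `pairFlux_shell_lt_top`.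

## References

* C. Cercignani, R. Illner, M. Pulvirenti, *The Mathematical Theory of Dilute Gases*, Springer
  (1994), §4.2, App. 4.A pp. 107–111.
* I. Gallagher, L. Saint-Raymond, B. Texier, *From Newton to Boltzmann*, EMS (2013), proof of
  Prop. 4.1.1 p. 19.
-/

open MeasureTheory Set Function Filter Metric
open scoped ENNReal NNReal RealInnerProductSpace

namespace Literature.MathematicalPhysics.KineticTheory

open Literature.Analysis.FluidPDE

noncomputable section

variable {d : Type*} [Fintype d] {N : ℕ} {ε : ℝ}

/-! ### Ordered versus unordered pairs -/

/-- Off-diagonal double sums regrouped over unordered pairs: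
`Σ_{a ≠ b} F a b = Σ_{a < b} (F a b + F b a)`. [folklore] -/
theorem campbell_sum_offdiag {M : Type*} [AddCommMonoid M] (F : Fin N → Fin N → M) :
    (∑ a : Fin N, ∑ b : Fin N, if a = b then 0 else F a b) =
      ∑ a : Fin N, ∑ b : Fin N, if a < b then F a b + F b a else 0 := by
  have h1 : (∑ a : Fin N, ∑ b : Fin N, if a = b then 0 else F a b) =
      (∑ a : Fin N, ∑ b : Fin N, if a < b then F a b else 0) +
        ∑ a : Fin N, ∑ b : Fin N, if b < a then F a b else 0 := by
    rw [← Finset.sum_add_distrib]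
    refine Finset.sum_congr rfl fun a _ => ?_
    rw [← Finset.sum_add_distrib]
    refine Finset.sum_congr rfl fun b _ => ?_
    rcases lt_trichotomy a b with h | h | h
    · rw [if_neg h.ne, if_pos h, if_neg (not_lt.2 h.le), add_zero]
    · subst h
      simp
    · rw [if_neg h.ne', if_neg (not_lt.2 h.le), if_pos h, zero_add]
  have h2 : (∑ a : Fin N, ∑ b : Fin N, if b < a then F a b else 0) =
      ∑ a : Fin N, ∑ b : Fin N, if a < b then F b a else 0 := Finset.sum_comm
  rw [h1, h2, ← Finset.sum_add_distrib]
  refine Finset.sum_congr rfl fun a _ => ?_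
  rw [← Finset.sum_add_distrib]
  refine Finset.sum_congr rfl fun b _ => ?_
  split_ifs <;> simp

/-- **The outgoing flux over unordered pairs**: for `0 ≤ ε < 1/2` and a measurable mark `g ≥ 0`,
`outgoingCollisionFlux ε N g = Σ_{a < b} Flux_{ab}(g(·,a,b) + g(·,b,a))` (the pair flux is symmetric
in the pair, `pairFlux_swap`, and additive in the mark). [folklore] -/
theorem outgoingCollisionFlux_eq_sum_lt (hε0 : 0 ≤ ε) (hε : ε < 1 / 2)
    {g : Config N d (UnitAddTorus d) → Fin N → Fin N → ℝ≥0∞} (hg : ∀ i j, Measurable fun w => g w i j) :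
    outgoingCollisionFlux ε N g =
      ∑ a : Fin N, ∑ b : Fin N, if a < b then
        ∫⁻ z : Config N d (UnitAddTorus d), ∫⁻ ω : Metric.sphere (0 : EuclideanSpace ℝ d) 1,
          ENNReal.ofReal (ε ^ (Fintype.card d - 1) * ⟪((ω : EuclideanSpace ℝ d)), (z a).2 - (z b).2⟫) *
            (hardSphereDomain (Torus.geometry d) N ε).indicator (fun w => g w a b + g w b a)
              (contactInsert ε a b (ω : EuclideanSpace ℝ d) z)
          ∂(volume : Measure (EuclideanSpace ℝ d)).toSphere
        else 0 := by
  unfold outgoingCollisionFlux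
  rw [campbell_sum_offdiag]
  refine Finset.sum_congr rfl fun a _ => Finset.sum_congr rfl fun b _ => ?_
  by_cases hab : a < b
  · rw [if_pos hab, if_pos hab]
    rw [← pairFlux_swap hε0 hε hab.ne (hg b a)]
    exact (lintegral_fluxPair_add (g' := fun w i j => g w j i) ε hg a b).symm
  · rw [if_neg hab, if_neg hab]

/-- Scaling a shell mark: `1_D · (c·1{E ≤ E₀}) = c · (1_D · 1{E ≤ E₀})` pointwise. [folklore] -/
theorem campbell_indicator_shellMark_const (D : Set (Config N d (UnitAddTorus d))) (E₀ : ℝ) (c : ℝ≥0)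
    (x : Config N d (UnitAddTorus d)) :
    D.indicator (fun w => if configEnergy w ≤ E₀ then (c : ℝ≥0∞) else 0) x =
      (c : ℝ≥0∞) * D.indicator (fun w => if configEnergy w ≤ E₀ then (1 : ℝ≥0∞) else 0) x := by
  by_cases hx : x ∈ D
  · rw [indicator_of_mem hx, indicator_of_mem hx]
    split_ifs <;> simp
  · rw [indicator_of_notMem hx, indicator_of_notMem hx, mul_zero]

/-! ### The upper bound -/

/-- **`UB`: the sharp upper bound for energy-shell marks.** For `0 < ε < 1/2`, a hard-sphere flow
structure `Φ` on `(T^d × ℝ^d)^N`, `E₀`, `c ≥ 0` and `τ > 0`: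
`∫ CPS_{(0,τ]}(c·1{E ≤ E₀}) dLiouville ≤ τ · outgoingCollisionFlux ε N (c·1{E ≤ E₀}) < ∞`.
On the shell the collision pair sum is `2c ×` the number of collision times in `(0, τ]`
(`collisionPairSum_shellMark`); the sharp count bound with the one-window volume bound gives
`∫_{shell} # ≤ τ Σ_{a<b} Flux_{ab}(1_{shell})`, and `Σ_{a<b} 2 Flux_{ab} = outgoingCollisionFlux`.
[cite: CIP1994, App. 4.A pp. 107–111] -/
theorem campbell_upperBound (d : Type*) [Fintype d] (N : ℕ) (ε : ℝ) (hε : 0 < ε) (hε' : ε < 1 / 2)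
    (Φ : HardSphereFlow (Torus.geometry d) ε N) (E₀ : ℝ) (c : ℝ≥0) (τ : ℝ) (hτ : 0 < τ) :
    (∫⁻ z, Φ.collisionPairSum (Ioc 0 τ)
        (fun _ w _ _ => if configEnergy w ≤ E₀ then (c : ℝ≥0∞) else 0) z ∂(liouville (Torus.geometry d) N ε) ≤
      ENNReal.ofReal τ *
        outgoingCollisionFlux ε N (fun (w : Config N d (UnitAddTorus d)) _ _ =>
          if configEnergy w ≤ E₀ then (c : ℝ≥0∞) else 0)) ∧
    outgoingCollisionFlux ε N (fun (w : Config N d (UnitAddTorus d)) (_ _ : Fin N) =>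
      if configEnergy w ≤ E₀ then (c : ℝ≥0∞) else 0) ≠ ⊤ := by
  have hε2 : ε < 2⁻¹ := by rw [inv_eq_one_div]; exact hε'
  have hmark : ∀ e : ℝ, ∀ i j : Fin N, Measurable fun w : Config N d (UnitAddTorus d) =>
      (fun (w : Config N d (UnitAddTorus d)) (_ _ : Fin N) => if configEnergy w ≤ e then (c : ℝ≥0∞) else 0) w i j :=
    fun e _ _ => Measurable.ite (Alexander.measurableSet_energyShell _) measurable_const measurable_const
  refine ⟨?_, ?_⟩
  swap
  · -- finiteness
    unfold outgoingCollisionFlux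
    refine ENNReal.sum_ne_top.2 fun a _ => ENNReal.sum_ne_top.2 fun b _ => ?_
    split_ifs
    · exact ENNReal.zero_ne_top
    · exact (pairFlux_shell_lt_top ε a b E₀ c).ne
  -- the bound
  rcases lt_or_ge E₀ 0 with hE₀ | hE₀
  · -- empty shell: the collision side vanishes
    have h0 : ∀ᵐ z ∂(liouville (Torus.geometry d) N ε), Φ.collisionPairSum (Ioc 0 τ)
        (fun _ w _ _ => if configEnergy w ≤ E₀ then (c : ℝ≥0∞) else 0) z = 0 := by
      filter_upwards [Φ.ae_mem_good] with z hz
      rw [collisionPairSum_shellMark hε2 Φ hz E₀ c τ, if_neg]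
      exact not_le.2 (hE₀.trans_le (by unfold configEnergy; positivity))
    rw [lintegral_congr_ae h0, lintegral_zero]
    exact bot_le
  · -- `E₀ = V²/2`
    set V := Real.sqrt (2 * E₀) with hVdef
    have hV : 0 ≤ V := Real.sqrt_nonneg _
    have hVE : V ^ 2 / 2 = E₀ := by
      rw [hVdef, Real.sq_sqrt (by positivity)]; ring
    clear_value V
    subst hVE
    -- the collision side on the shell
    set S : Set (Config N d (UnitAddTorus d)) := {z | configEnergy z ≤ V ^ 2 / 2} with hSdef
    have hS : MeasurableSet S := Alexander.measurableSet_energyShell _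
    have hlhs : ∫⁻ z, Φ.collisionPairSum (Ioc 0 τ)
        (fun _ w _ _ => if configEnergy w ≤ V ^ 2 / 2 then (c : ℝ≥0∞) else 0) z ∂(liouville (Torus.geometry d) N ε) =
        2 * (c : ℝ≥0∞) * ∫⁻ z in S,
          ((collisionTimes (Torus.geometry d) ε (fun s => Φ.flow s z) ∩ Ioc 0 τ).ncard : ℝ≥0∞)
            ∂(liouville (Torus.geometry d) N ε) := by
      have h1 : ∀ᵐ z ∂(liouville (Torus.geometry d) N ε), Φ.collisionPairSum (Ioc 0 τ)
          (fun _ w _ _ => if configEnergy w ≤ V ^ 2 / 2 then (c : ℝ≥0∞) else 0) z =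
          S.indicator (fun z => 2 * (c : ℝ≥0∞) *
            ((collisionTimes (Torus.geometry d) ε (fun s => Φ.flow s z) ∩ Ioc 0 τ).ncard : ℝ≥0∞)) z := by
        filter_upwards [Φ.ae_mem_good] with z hz
        rw [collisionPairSum_shellMark hε2 Φ hz _ c τ]
        by_cases hzS : z ∈ S
        · rw [indicator_of_mem hzS, if_pos (show configEnergy z ≤ V ^ 2 / 2 from hzS)]
        · rw [indicator_of_notMem hzS, if_neg (show ¬ configEnergy z ≤ V ^ 2 / 2 from hzS)]
      rw [lintegral_congr_ae h1, lintegral_indicator hS,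
        lintegral_const_mul' _ _ (ENNReal.mul_ne_top ENNReal.ofNat_ne_top ENNReal.coe_ne_top)]
    -- the flux side: the pair fluxes of the shell
    set F : ℝ≥0∞ := ∑ p : Fin N × Fin N, if p.1 < p.2 then
      ∫⁻ z : Config N d (UnitAddTorus d), ∫⁻ ω : Metric.sphere (0 : EuclideanSpace ℝ d) 1,
        ENNReal.ofReal (ε ^ (Fintype.card d - 1) * ⟪((ω : EuclideanSpace ℝ d)), (z p.1).2 - (z p.2).2⟫) *
          (hardSphereDomain (Torus.geometry d) N ε).indicator
            (fun w => if configEnergy w ≤ V ^ 2 / 2 then (1 : ℝ≥0∞) else 0)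
            (contactInsert ε p.1 p.2 (ω : EuclideanSpace ℝ d) z)
        ∂(volume : Measure (EuclideanSpace ℝ d)).toSphere else 0 with hFdef
    -- the one-window volume bound
    have hvol : ∀ δ : ℝ, 0 < δ → ε + 2 * (2 * V * δ) < 2⁻¹ →
        ∑ p : Fin N × Fin N, (if p.1 < p.2 then
          volume (Alexander.hitPiece N ε (2 * V * δ) δ p.1 p.2 ∩
            {u : Config N d (UnitAddTorus d) | configEnergy u ≤ V ^ 2 / 2}) else 0) ≤
          ENNReal.ofReal δ * F := by
      intro δ hδ hch
      rw [hFdef, Finset.mul_sum]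
      refine Finset.sum_le_sum fun p _ => ?_
      by_cases hp : p.1 < p.2
      · rw [if_pos hp, if_pos hp]
        exact campbell_volume_hitPiece_shell_le hε hch le_rfl hV hδ.le hp.ne
      · rw [if_neg hp, if_neg hp, mul_zero]
    have hcount := lintegral_ncard_collisionTimes_le_of_hitPiece_volume hε hε2 Φ hV hτ.le F hvol
    -- the outgoing flux of the shell mark is `2c F`
    have hflux : outgoingCollisionFlux ε N (fun (w : Config N d (UnitAddTorus d)) (_ _ : Fin N) =>
        if configEnergy w ≤ V ^ 2 / 2 then (c : ℝ≥0∞) else 0) = 2 * (c : ℝ≥0∞) * F := by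
      rw [outgoingCollisionFlux_eq_sum_lt hε.le hε' (hmark _), hFdef, Fintype.sum_prod_type, Finset.mul_sum]
      refine Finset.sum_congr rfl fun a _ => ?_
      rw [Finset.mul_sum]
      refine Finset.sum_congr rfl fun b _ => ?_
      by_cases hab : a < b
      · rw [if_pos hab, if_pos hab]
        -- `g(·,a,b) + g(·,b,a) = 2c · 1_shell` inside the pair flux
        have hsum : ∀ x : Config N d (UnitAddTorus d),
            (hardSphereDomain (Torus.geometry d) N ε).indicator
              (fun w => (if configEnergy w ≤ V ^ 2 / 2 then (c : ℝ≥0∞) else 0) +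
                (if configEnergy w ≤ V ^ 2 / 2 then (c : ℝ≥0∞) else 0)) x =
            2 * (c : ℝ≥0∞) * (hardSphereDomain (Torus.geometry d) N ε).indicator
              (fun w => if configEnergy w ≤ V ^ 2 / 2 then (1 : ℝ≥0∞) else 0) x := by
          intro x
          rw [mul_assoc, ← campbell_indicator_shellMark_const]
          by_cases hx : x ∈ hardSphereDomain (Torus.geometry d) N ε
          · rw [indicator_of_mem hx, indicator_of_mem hx, two_mul]
          · rw [indicator_of_notMem hx, indicator_of_notMem hx, mul_zero]
        have h2c : (2 : ℝ≥0∞) * (c : ℝ≥0∞) ≠ ⊤ := ENNReal.mul_ne_top ENNReal.ofNat_ne_top ENNReal.coe_ne_top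
        rw [← lintegral_const_mul' _ _ h2c]
        refine lintegral_congr fun z => ?_
        rw [← lintegral_const_mul' _ _ h2c]
        refine lintegral_congr fun ω => ?_
        rw [hsum, mul_left_comm]
      · rw [if_neg hab, if_neg hab, mul_zero]
    rw [hlhs, hflux]
    calc 2 * (c : ℝ≥0∞) * ∫⁻ z in S,
          ((collisionTimes (Torus.geometry d) ε (fun s => Φ.flow s z) ∩ Ioc 0 τ).ncard : ℝ≥0∞)
            ∂(liouville (Torus.geometry d) N ε)
        ≤ 2 * (c : ℝ≥0∞) * (ENNReal.ofReal τ * F) := by gcongr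
      _ = ENNReal.ofReal τ * (2 * (c : ℝ≥0∞) * F) := by ring

end

end Literature.MathematicalPhysics.KineticTheory
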